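import Literature.NumberTheory.Automorphic.JacquetIsotypicExtensionSplitting            -- ★ row 79 p853756 (this seat): (SEP) `exists_section_or_exists_injective_of_isotypic_normalizedJacquet`, (SEP-T)
import Literature.NumberTheory.Automorphic.JacquetNonzeroEmbedsNormalizedInd            -- ★ `torusU_mul_comm`, `deltaChar_cmBorelTriple_eq_one_of_mem_N`; brings ★ `cmBorelTriple`, `cmPrincipalSeries`, `locallyCompactSpace_cmBorelU`
import Literature.NumberTheory.Automorphic.UnitaryGroupUnipotentLimitCompactOpen         -- ★ `isLimitOfCompactOpen_cmBorelTriple_N`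
import Literature.NumberTheory.Automorphic.IrreducibleClassesConstituents                -- ★ `IrrClass.IsConstituentOf.of_injective` ∕ `.of_surjective`, `isConstituentOf_mk_self`
import Summits.HodgeConjecture.HodgeConjecture.Theorems.F0P3cStCharTSJacquetLine          -- ★ `normalizedJacquet_apply_of_equiv_twist` (line letter ⇒ isotypy)
import HarnessLib

/-!
# F0 · P3c · line LH6 «StCharTS» — E1 brick «(SEP) @ DATUM»: line-Jacquet block separation dressed at the CM Borel triple `cmBorelTriple L N v` of
# `G = U(Φ_N)(L⁺_v)` — every smooth extension of a class with LINE Jacquet module by a class realised in `i_B(χ)`, `χ ≠ θ`, SPLITS unless the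
# quotient class is a constituent of `i_B(χ)` (Bernstein–Zelevinsky 1977 §1.9, §2.3; Casselman 1995 §3.2, §6.3; Rogawski 1990 §12.2)

Cell `pub/hodgecm-mathlib`, crux H413 = `stmt-HodgeConjecture-24833` (`--supports` lane, helper; THEOREMS ONLY — no definition ∕ instance ∕ notation ∕ named fact ∕ `sorry`).
Namespace `Summit.HodgeConjecture.HodgeConjecture.Cruxes.H413.F0P3cStCharTSJacquetLineSplitAtDatum`.  EXT-ROAD v2 piece (4) «(SEP) @ DATUM» (LEAD F0P3a-plan (g17) T16-03 «= GO-LOW»;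
keepers F0P3a-p03 (g31) k113 ∕ (g32); seat F0P3a-p06 (g27)) — the ORGAN-SIDE DRESSING of ★ row 79 `Representation.exists_section_or_exists_injective_of_isotypic_normalizedJacquet`
(`Literature/NumberTheory/Automorphic/JacquetIsotypicExtensionSplitting.lean`, generic parabolic triple) at the tree's CM datum, in the pattern of ★ «FN @ DATUM» (`F0P3cStCharTSFrobeniusNaturality`):
the three structural hypotheses are DISCHARGED (`hN` = ★ `isLimitOfCompactOpen_cmBorelTriple_N`, `hδ` = ★ `deltaChar_cmBorelTriple_eq_one_of_mem_N`, `hcomm` = ★ `torusU_mul_comm`), the induced side is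
read as ★ `cmPrincipalSeries L N v χ` (`= normalizedInd (cmBorelTriple L N v) ((trivial ℂ T ℂ).twist χ)` by `rfl`, ★ `cmPrincipalSeries_eq_normalizedInd`), and the quotient's isotypy is read off the LINE letter
`Nonempty ((r.ρ.normalizedJacquet (cmBorelTriple L N v)).Equiv ((trivial ℂ T ℂ).twist θ))` of ★ `labelledPair_of_reducible` ∕ ★ 64-B (via ★ `normalizedJacquet_apply_of_equiv_twist`).
CONSUMER: the (X3′) assembly head `isEllipticPair_of_innerG_ne_zero_of_not_wild` (case B): §2's conclusion IS the `hsplit₂` binder of ★ row 80 (X0′) CROSS-TRACE-ZERO ∕ ★ (J′)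
`finrank_intertwiningMap_presentation_of_isSmooth` at `V := r.ρ`, `W := r′.ρ`, TOKEN FOR TOKEN.

THE MATHEMATICS.  ★ 79: over a parabolic triple with `δ_P|_N = 1`, `N` a union of compact opens and `M` commutative, a smooth extension `0 → W → E → V → 0` with `V` irreducible,
`r_P(V)` `θ`-isotypic and `W ↪ i_P(σ)` (`σ` `χ`-isotypic, `χ ≠ θ`) either splits or `E ↪ i_P(σ)` over the embedding of `W`.  At the CM Borel `B = TN` of `U(Φ_N)(L⁺_v)` all three side
conditions hold (★), `σ := ℂ_χ`; and in the second alternative `V = E∕W` is a CONSTITUENT of `i_B(χ)` (★ `isConstituentOf_mk_self` → `.of_surjective p` → `.of_injective Φ`) — so if the class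
`⟦r⟧` is NOT a constituent of `i_B(χ)`, EVERY smooth extension of `r` by `r′` splits.  [BernsteinZelevinsky1977 §1.9 Prop. 1.9, §2.3]; [Casselman1995 §3.2 Thm. 3.2.3–3.2.4, §6.3 Cor. 6.3.9];
[Rogawski1990 §12.2 p. 173 (the principal series of `U(3)`)].

* §1 `exists_section_or_exists_injective_cmBorel` — ★ 79 §1 at `cmBorelTriple L N v` with `hN hδ hcomm hσ` discharged, `hθ` = the line letter, target `cmPrincipalSeries L N v χ`.
* §2 **`forall_smooth_extension_split_of_not_isConstituentOf`** — for `r r′ : SmoothIrrep G`: `¬ ⟦r⟧.IsConstituentOf (i_B χ)` ⇒ the `hsplit₂` text of ★ (J′)∕★ 80 verbatim.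
* §3 (rf v2, keeper F0P3a-p03 (g32) k05 «ADD IT NOW») `isConstituentOf_cmPrincipalSeries_of_equiv_twist` (LINE letter `ℂ_θ` ⇒ `⟦r⟧` is a constituent of `i_B(θ)`: ★ Frobenius embedding
  `exists_injective_intertwiningMap_normalizedInd_of_ne_zero`), `ne_of_not_isConstituentOf` (case B ⇒ `χ ≠ θ`), **`forall_smooth_extension_split_of_not_isConstituentOf'`** (§2 WITHOUT `hne`).

ELABORATION NOTE (measured, local, ★ precedent «FN @ DATUM» ∕ ★ 63-C class): the statements put `cmPrincipalSeries L N v χ`-typed intertwiners where ★ 79 has `normalizedInd …`-typed ones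
(definitionally equal; `whnf` on the CM carrier): §1 needs `maxHeartbeats 800000` (200 000 FAILS at `whnf`, 800 000 PASSES — probe `DatumProbe` 348baa4a, this seat); §3's first head needs
`maxHeartbeats 1600000` (800 000 FAILS, 1 600 000 PASSES: the ★ embedding lands `normalizedInd`-typed and is read `cmPrincipalSeries`-typed); §2, `ne_of_…`, §2′ run at the default.
HONEST LABEL: count-neutral helper (E1 = PRINT; the (b)-REST NOT-WILD ride exists only when (X0′)∕(X0′-NW)∕(X3′) are ★ and the rider is served); h413 OPEN; HC_CM is proved only modulo
the 7 printed citations (2 remaining named inputs hLiu418 = stmt-HodgeConjecture-24832, h413 = stmt-HodgeConjecture-24833) until rung 0 closes.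

## References
* [BernsteinZelevinsky1977] I. N. Bernstein, A. V. Zelevinsky, *Induced representations of reductive p-adic groups I*, Ann. Sci. ÉNS 10 (1977), §1.9 Prop. 1.9 (a)–(b), §2.3.
* [Casselman1995] W. Casselman, *Introduction to the theory of admissible representations of p-adic reductive groups* (1995), §3.2 Thm. 3.2.3–3.2.4, §6.3 Cor. 6.3.9.
* [Rogawski1990] J. D. Rogawski, *Automorphic Representations of Unitary Groups in Three Variables*, Ann. of Math. Stud. 123 (1990), §12.2 p. 173.
-/

set_option autoImplicit false
-- the mandated namespace has the single-problem summit's repeated segment (`HodgeConjecture.HodgeConjecture`)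
set_option linter.dupNamespace false

noncomputable section

open NumberField IsDedekindDomain Function
open Literature.NumberTheory.Automorphic Literature.NumberTheory.Automorphic.UnitaryGroup Representation

namespace Summit.HodgeConjecture.HodgeConjecture.Cruxes.H413.F0P3cStCharTSJacquetLineSplitAtDatum

variable (L : Type) [Field L] [NumberField L] [IsCMField L] (N : ℕ) (v : HeightOneSpectrum (𝓞 ↥(maximalRealSubfield L)))

/-! ## §1 ★ 79 (SEP) at the CM Borel triple: `hN`, `hδ`, `hcomm`, `hσ` discharged; isotypy from the line letter -/

set_option maxHeartbeats 800000 in  -- `cmPrincipalSeries`-typed intertwiners against ★ 79's `normalizedInd`-typed binders (`rfl` bridge, CM carrier `whnf`): measured 200 000 FAIL ∕ 800 000 PASS (see ELABORATION NOTE)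
/-- **(SEP) @ DATUM, §1.**  At the CM Borel triple `cmBorelTriple L N v` of `G = U(Φ_N)(L⁺_v)`: for an exact sequence `0 → W →ⁱ E →ᵖ V → 0` of representations with `W, E` smooth and
`V` irreducible (no `G`-stable subspace other than `⊥, ⊤`), whose quotient has normalised Jacquet module ISOMORPHIC TO THE LINE `ℂ_θ` (the letter of ★ `labelledPair_of_reducible` ∕
★ 64-B), and an embedding `ι : W ↪ i_B(χ) = cmPrincipalSeries L N v χ` with `χ ≠ θ`: EITHER `p` has a `G`-equivariant section OR `E` embeds in `i_B(χ)` by a map extending `ι`.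
(★ 79 with `hN` = ★ `isLimitOfCompactOpen_cmBorelTriple_N`, `hδ` = ★ `deltaChar_cmBorelTriple_eq_one_of_mem_N`, `hcomm` = ★ `torusU_mul_comm`, `σ := (trivial ℂ T ℂ).twist χ`.)
[cite: BernsteinZelevinsky1977, §1.9 Prop. 1.9 (a)–(b), §2.3] [cite: Casselman1995, §3.2 Thm. 3.2.3–3.2.4, §6.3] [cite: Rogawski1990, §12.2 p. 173] -/
theorem exists_section_or_exists_injective_cmBorel
    {XW XE XV : Type*} [AddCommGroup XW] [Module ℂ XW] [AddCommGroup XE] [Module ℂ XE] [AddCommGroup XV] [Module ℂ XV]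
    {ρW : Representation ℂ ↥(unitaryGroupOfForm (conjLocal L (IsCMField.complexConj L) v) (cmLocalForm L N v)) XW}
    {ρE : Representation ℂ ↥(unitaryGroupOfForm (conjLocal L (IsCMField.complexConj L) v) (cmLocalForm L N v)) XE}
    {ρV : Representation ℂ ↥(unitaryGroupOfForm (conjLocal L (IsCMField.complexConj L) v) (cmLocalForm L N v)) XV}
    (hW : ρW.IsSmooth) (hE : ρE.IsSmooth)
    (i : ρW.IntertwiningMap ρE) (p : ρE.IntertwiningMap ρV) (hi : Injective i)
    (hex : LinearMap.ker p.toLinearMap = LinearMap.range i.toLinearMap) (hp : Surjective p)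
    (hVirr : ∀ S : Submodule ℂ XV, (∀ g, S ≤ S.comap (ρV g)) → S = ⊥ ∨ S = ⊤)
    (θ χ : ↥(torusU (conjLocal L (IsCMField.complexConj L) v) (cmLocalForm L N v)) →* ℂˣ) (hne : χ ≠ θ)
    (hθ : haveI := locallyCompactSpace_cmBorelU L N v
      Nonempty ((ρV.normalizedJacquet (cmBorelTriple L N v)).Equiv
        ((Representation.trivial ℂ ↥(torusU (conjLocal L (IsCMField.complexConj L) v) (cmLocalForm L N v)) ℂ).twist θ)))
    (ι : ρW.IntertwiningMap (cmPrincipalSeries L N v χ)) (hι : Injective ι) :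
    (∃ s : ρV.IntertwiningMap ρE, p.comp s = IntertwiningMap.id ρV) ∨
      ∃ Φ : ρE.IntertwiningMap (cmPrincipalSeries L N v χ), Injective Φ ∧ Φ.comp i = ι := by
  haveI := locallyCompactSpace_cmBorelU L N v
  obtain ⟨e⟩ := hθ
  -- isotypy of `r_B(V)` from the line letter (★ `normalizedJacquet_apply_of_equiv_twist`)
  have hθ' : ∀ (m : ↥(cmBorelTriple L N v).M) (x : ((cmBorelTriple L N v).restrict ρV).Coinvariants),
      ρV.normalizedJacquet (cmBorelTriple L N v) m x = ((θ m : ℂˣ) : ℂ) • x :=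
    fun m x => F0P3cStCharTSJacquetLine.normalizedJacquet_apply_of_equiv_twist (cmBorelTriple L N v) e m x
  -- `σ := ℂ_χ` is `χ`-isotypic
  have hσ : ∀ (m : ↥(cmBorelTriple L N v).M) (y : ℂ),
      ((Representation.trivial ℂ ↥(torusU (conjLocal L (IsCMField.complexConj L) v) (cmLocalForm L N v)) ℂ).twist χ) m y = ((χ m : ℂˣ) : ℂ) • y :=
    fun m y => by simp [Representation.twist_apply]
  rcases exists_section_or_exists_injective_of_isotypic_normalizedJacquet (cmBorelTriple L N v)
      (isLimitOfCompactOpen_cmBorelTriple_N L N v) (deltaChar_cmBorelTriple_eq_one_of_mem_N L N v)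
      (fun m m' => torusU_mul_comm _ _ m m') hW hE i p hi hex hp hVirr θ hθ' _ χ hσ hne ι hι with h | ⟨Φ, hΦ, hΦi⟩
  · exact Or.inl h
  · exact Or.inr ⟨Φ, hΦ, hΦi⟩

/-! ## §2 The consumer form: `¬ ⟦r⟧.IsConstituentOf (i_B χ)` ⇒ every smooth extension of `r` by `r′` splits (the `hsplit₂` text of ★ (J′) ∕ ★ 80, verbatim) -/

/-- **(SEP) @ DATUM, §2 — THE `hsplit₂` SUPPLIER OF CASE B.**  At the CM Borel triple of `G = U(Φ_N)(L⁺_v)`: let `r, r′` be smooth irreducibles, `r` with LINE normalised Jacquet module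
`≅ ℂ_θ` (★ `labelledPair_of_reducible` ∕ ★ 64-B letter), `r′` EMBEDDED in `i_B(χ) = cmPrincipalSeries L N v χ` (★ N2 `u3PrincipalSeriesConstituentEmbeds_holds` letter), `χ ≠ θ`, and
suppose the class `⟦r⟧` is NOT a constituent of `i_B(χ)`.  Then every smooth extension `0 → r′ →ⁱ E →ᵖ r → 0` splits — stated in the letters of ★ (J′)
`finrank_intertwiningMap_presentation_of_isSmooth`'s `hsplit` at `V := r.ρ`, `W := r′.ρ` (= ★ 80's `hsplit₂`).  (§1; the second alternative would make `⟦r⟧` a constituent of `i_B(χ)` by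
★ `isConstituentOf_mk_self` → `.of_surjective p` → `.of_injective Φ`; irreducibility of `r` = `IsSimpleOrder (Subrepresentation r.ρ)`.)
[cite: BernsteinZelevinsky1977, §1.9 Prop. 1.9 (a)–(b), §2.1–2.3] [cite: Casselman1995, §3.2 Thm. 3.2.3–3.2.4, §6.3 Cor. 6.3.9] [cite: Rogawski1990, §12.2 p. 173] -/
theorem forall_smooth_extension_split_of_not_isConstituentOf
    (r r' : SmoothIrrep ↥(unitaryGroupOfForm (conjLocal L (IsCMField.complexConj L) v) (cmLocalForm L N v)))
    (θ χ : ↥(torusU (conjLocal L (IsCMField.complexConj L) v) (cmLocalForm L N v)) →* ℂˣ) (hne : χ ≠ θ)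
    (hθ : haveI := locallyCompactSpace_cmBorelU L N v
      Nonempty ((r.ρ.normalizedJacquet (cmBorelTriple L N v)).Equiv
        ((Representation.trivial ℂ ↥(torusU (conjLocal L (IsCMField.complexConj L) v) (cmLocalForm L N v)) ℂ).twist θ)))
    (ι : r'.ρ.IntertwiningMap (cmPrincipalSeries L N v χ)) (hι : Injective ι)
    (hnot : ¬ (IrrClass.mk r).IsConstituentOf (cmPrincipalSeries L N v χ)) :
    ∀ (E : Type) [AddCommGroup E] [Module ℂ E]
      (ρE : Representation ℂ ↥(unitaryGroupOfForm (conjLocal L (IsCMField.complexConj L) v) (cmLocalForm L N v)) E), ρE.IsSmooth →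
      ∀ (i : r'.ρ.IntertwiningMap ρE) (p : ρE.IntertwiningMap r.ρ),
        Injective i → LinearMap.ker p.toLinearMap = LinearMap.range i.toLinearMap → Surjective p →
          ∃ s : r.ρ.IntertwiningMap ρE, p.comp s = IntertwiningMap.id r.ρ := by
  intro E _ _ ρE hE i p hi hex hp
  -- irreducibility of `r` in submodule form
  have hVirr : ∀ S : Submodule ℂ r.V, (∀ g, S ≤ S.comap (r.ρ g)) → S = ⊥ ∨ S = ⊤ := fun S hS => by
    haveI := r.isIrreducible
    rcases IsSimpleOrder.eq_bot_or_eq_top (⟨S, fun g _ hx => hS g hx⟩ : Subrepresentation r.ρ) with h | h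
    · exact Or.inl (congrArg Subrepresentation.toSubmodule h)
    · exact Or.inr (congrArg Subrepresentation.toSubmodule h)
  rcases exists_section_or_exists_injective_cmBorel L N v r'.isSmooth hE i p hi hex hp hVirr θ χ hne hθ ι hι with h | ⟨Φ, hΦ, -⟩
  · exact h
  · -- `⟦r⟧` would be a constituent of `i_B(χ)`: `r = E ∕ i(r′)` is a quotient of `E ↪ i_B(χ)`
    exact absurd (((IrrClass.isConstituentOf_mk_self r).of_surjective p hp).of_injective Φ hΦ) hnot

/-! ## §3 (ED. 2) Case A's Frobenius step and the `hne`-free consumer form -/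

set_option maxHeartbeats 1600000 in  -- the ★ Frobenius embedding is `normalizedInd`-typed, the conclusion `cmPrincipalSeries`-typed (`rfl` bridge, CM carrier `whnf`): measured 800 000 FAIL ∕ 1 600 000 PASS
/-- **LINE LETTER ⇒ CONSTITUENT.**  If the normalised Jacquet module of the smooth irreducible `r` is isomorphic to the line `ℂ_θ`, then `⟦r⟧` is a constituent of
`i_B(θ) = cmPrincipalSeries L N v θ`: the equivalence is a non-zero `T`-map `r_B(r) → ℂ_θ`, Frobenius reciprocity (★ `exists_injective_intertwiningMap_normalizedInd_of_ne_zero`,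
`hδ` = ★ `deltaChar_cmBorelTriple_eq_one_of_mem_N`) turns it into an EMBEDDING `r ↪ i_B(θ)`, and an embedded irreducible is a constituent (★ `isConstituentOf_mk_self`, `.of_injective`).
This is the dichotomy step «`θ = χ′` ⇒ case A» of the (b)-REST assembly. [cite: BernsteinZelevinsky1977, §1.9 Prop. 1.9 (b), §2.3] [cite: Casselman1995, §3.2 Thm. 3.2.4, §6.3 Cor. 6.3.9]
[cite: Rogawski1990, §12.2 p. 173] -/
theorem isConstituentOf_cmPrincipalSeries_of_equiv_twist
    (r : SmoothIrrep ↥(unitaryGroupOfForm (conjLocal L (IsCMField.complexConj L) v) (cmLocalForm L N v)))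
    (θ : ↥(torusU (conjLocal L (IsCMField.complexConj L) v) (cmLocalForm L N v)) →* ℂˣ)
    (hθ : haveI := locallyCompactSpace_cmBorelU L N v
      Nonempty ((r.ρ.normalizedJacquet (cmBorelTriple L N v)).Equiv
        ((Representation.trivial ℂ ↥(torusU (conjLocal L (IsCMField.complexConj L) v) (cmLocalForm L N v)) ℂ).twist θ))) :
    (IrrClass.mk r).IsConstituentOf (cmPrincipalSeries L N v θ) := by
  haveI := locallyCompactSpace_cmBorelU L N v
  haveI := r.isIrreducible
  obtain ⟨e⟩ := hθ
  -- the equivalence is a non-zero `T`-map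
  have hψ : e.toIntertwiningMap ≠ 0 := fun h0 => by
    have h1 := congrArg (fun f : (r.ρ.normalizedJacquet (cmBorelTriple L N v)).IntertwiningMap
      ((Representation.trivial ℂ ↥(torusU (conjLocal L (IsCMField.complexConj L) v) (cmLocalForm L N v)) ℂ).twist θ) => f (e.symm 1)) h0
    simp only [Representation.Equiv.coe_toIntertwiningMap, Representation.Equiv.apply_symm_apply, IntertwiningMap.coe_zero,
      Pi.zero_apply] at h1
    exact one_ne_zero h1
  obtain ⟨f, hf⟩ := r.ρ.exists_injective_intertwiningMap_normalizedInd_of_ne_zero (cmBorelTriple L N v) r.isSmooth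
    (deltaChar_cmBorelTriple_eq_one_of_mem_N L N v) _ e.toIntertwiningMap hψ
  exact (IrrClass.isConstituentOf_mk_self r).of_injective f hf

/-- **`χ ≠ θ` FROM CASE B.**  If `r` has LINE normalised Jacquet module `ℂ_θ` and `⟦r⟧` is NOT a constituent of `i_B(χ)`, then `χ ≠ θ` (else §3 embeds `r` in `i_B(χ)`).
The (X3′) assembler's «case B ⇒ `hne`» in one call. [cite: BernsteinZelevinsky1977, §1.9 Prop. 1.9 (b), §2.3] [cite: Casselman1995, §3.2 Thm. 3.2.4, §6.3 Cor. 6.3.9] [cite: Rogawski1990, §12.2 p. 173] -/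
theorem ne_of_not_isConstituentOf
    (r : SmoothIrrep ↥(unitaryGroupOfForm (conjLocal L (IsCMField.complexConj L) v) (cmLocalForm L N v)))
    (θ χ : ↥(torusU (conjLocal L (IsCMField.complexConj L) v) (cmLocalForm L N v)) →* ℂˣ)
    (hθ : haveI := locallyCompactSpace_cmBorelU L N v
      Nonempty ((r.ρ.normalizedJacquet (cmBorelTriple L N v)).Equiv
        ((Representation.trivial ℂ ↥(torusU (conjLocal L (IsCMField.complexConj L) v) (cmLocalForm L N v)) ℂ).twist θ)))
    (hnot : ¬ (IrrClass.mk r).IsConstituentOf (cmPrincipalSeries L N v χ)) : χ ≠ θ := by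
  rintro rfl
  exact hnot (isConstituentOf_cmPrincipalSeries_of_equiv_twist L N v r χ hθ)

/-- **(SEP) @ DATUM, §4 — THE `hsplit₂` SUPPLIER OF CASE B, `hne`-FREE.**  As §2, with `χ ≠ θ` DERIVED: if `χ = θ`, §3 makes `⟦r⟧` a constituent of `i_B(χ)`, against `hnot`.  So the
(X3′) assembler's case B needs exactly: the line letter of `r`, the embedding of `r′` in `i_B(χ)`, and `¬ ⟦r⟧.IsConstituentOf (i_B χ)`.
[cite: BernsteinZelevinsky1977, §1.9 Prop. 1.9 (a)–(b), §2.1–2.3] [cite: Casselman1995, §3.2 Thm. 3.2.3–3.2.4, §6.3 Cor. 6.3.9] [cite: Rogawski1990, §12.2 p. 173] -/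
theorem forall_smooth_extension_split_of_not_isConstituentOf'
    (r r' : SmoothIrrep ↥(unitaryGroupOfForm (conjLocal L (IsCMField.complexConj L) v) (cmLocalForm L N v)))
    (θ χ : ↥(torusU (conjLocal L (IsCMField.complexConj L) v) (cmLocalForm L N v)) →* ℂˣ)
    (hθ : haveI := locallyCompactSpace_cmBorelU L N v
      Nonempty ((r.ρ.normalizedJacquet (cmBorelTriple L N v)).Equiv
        ((Representation.trivial ℂ ↥(torusU (conjLocal L (IsCMField.complexConj L) v) (cmLocalForm L N v)) ℂ).twist θ)))
    (ι : r'.ρ.IntertwiningMap (cmPrincipalSeries L N v χ)) (hι : Injective ι)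
    (hnot : ¬ (IrrClass.mk r).IsConstituentOf (cmPrincipalSeries L N v χ)) :
    ∀ (E : Type) [AddCommGroup E] [Module ℂ E]
      (ρE : Representation ℂ ↥(unitaryGroupOfForm (conjLocal L (IsCMField.complexConj L) v) (cmLocalForm L N v)) E), ρE.IsSmooth →
      ∀ (i : r'.ρ.IntertwiningMap ρE) (p : ρE.IntertwiningMap r.ρ),
        Injective i → LinearMap.ker p.toLinearMap = LinearMap.range i.toLinearMap → Surjective p →
          ∃ s : r.ρ.IntertwiningMap ρE, p.comp s = IntertwiningMap.id r.ρ := by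
  exact forall_smooth_extension_split_of_not_isConstituentOf L N v r r' θ χ (ne_of_not_isConstituentOf L N v r θ χ hθ hnot) hθ ι hι hnot

end Summit.HodgeConjecture.HodgeConjecture.Cruxes.H413.F0P3cStCharTSJacquetLineSplitAtDatum

end
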